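import Literature.NumberTheory.CubicFields.PsiFourierNormalForm
import Literature.NumberTheory.CubicFields.NonFundCountShintaniCoeff
import HarnessLib

/-!
# Multiplicativity of `Ψ̂_{q²}` in `q`: the Chinese remainder theorem for the Fourier transform (eq:FT)
(Bhargava–Taniguchi–Thorne 2023, Prop. 5.2, first clause)

Topic `Literature/NumberTheory/CubicFields`; built on `ShintaniDualDensity.lean` (`dualPairing`, `eMod`,
`fourierDual`), `NonFundCountShintaniCoeff.lean` (the sieve weight `Φ_q = psiMod q` on `V(ℤ/16q²ℤ)`) and
`PsiFourierNormalForm.lean` (the local weight `Ψ_{p²} = psiLocal p` on `V(ℤ/p²ℤ)`). Everything here is PROVED;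
the only definition is the explicit CRT reduction map `crtForms`.

BTT Prop. 5.2 opens with "the function `Ψ̂_{q²}(x)` is multiplicative in `q`". We prove the underlying
Chinese-remainder factorisation of the transform (eq:FT) of a tensor product `Φ = Φ₁ ⊗ Φ₂` at coprime levels
`n = n₁n₂` (`fourierDual_eq_mul_of_coprime`: `Φ̂(f) = Φ̂₁(c₁f)·Φ̂₂(c₂f)` with Bézout coefficients
`c₁n₂ + c₂n₁ = 1`, the splitting `e(t/n) = e(c₁t/n₁)e(c₂t/n₂)` of the character and the bijection
`V(ℤ/nℤ) → V(ℤ/n₁ℤ) × V(ℤ/n₂ℤ)`), the invariance `Ψ̂_{p²}(c·f) = Ψ̂_{p²}(f)` for `p ∤ c` which absorbs the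
units (`fourierDual_psiLocal_smul`), the peeling identity `Φ_{pq'} = Ψ_{p²} ⊗ Φ_{q'}` for the tree's sieve
weight (`psiMod_peel`; at an odd prime the local condition of `psiMod` is `p² ∣ Disc`, i.e. `psiLocal`), and
deduce the bound used in the proof of BTT Prop. 5.1:

* `norm_fourierDual_psiMod_le` — **`|Φ̂_q(f)| ≤ ∏_{p ∣ q, p ≥ 5} |Ψ̂_{p²}(f)|`** for squarefree `q` and `f` in
  the dual lattice (the factor at the primes `2, 3` is bounded trivially by `1`).

## References

* M. Bhargava, T. Taniguchi, F. Thorne, *Improved error estimates for the Davenport–Heilbronn theorems*,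
  Math. Ann. 389 (2024) = arXiv:2107.12819, §5, Prop. 5.2 [BhargavaTaniguchiThorne2023].
-/

noncomputable section

open Complex Finset
open Literature.NumberTheory.CubicFields.BinaryCubic

namespace Literature.NumberTheory.CubicFields

section Pairing

variable {m : ℕ}

/-- **`⟨c·f, y⟩ = c·⟨f, y⟩`** for `f` in the dual lattice (`3 ∣ b, c`, so that the integer divisions in
Shintani's pairing are exact). [folklore] -/
theorem dualPairing_smul {f : BinaryCubic ℤ} (hf : IsDualForm f) (c : ℤ) (y : BinaryCubic (ZMod m)) :
    dualPairing (c • f) y = (c : ZMod m) * dualPairing f y := by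
  obtain ⟨⟨b', hb'⟩, ⟨c', hc'⟩⟩ := hf
  have h1 : c * (3 * c') / 3 = c * c' := by
    rw [mul_left_comm, Int.mul_ediv_cancel_left _ three_ne_zero]
  have h2 : c * (3 * b') / 3 = c * b' := by
    rw [mul_left_comm, Int.mul_ediv_cancel_left _ three_ne_zero]
  have h3 : (3 * c' : ℤ) / 3 = c' := Int.mul_ediv_cancel_left _ three_ne_zero
  have h4 : (3 * b' : ℤ) / 3 = b' := Int.mul_ediv_cancel_left _ three_ne_zero
  simp only [dualPairing, smul_a, smul_b, smul_c, smul_d, hb', hc', h1, h2, h3, h4]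
  push_cast
  ring

/-- The dual lattice is stable under integer scaling. [folklore] -/
theorem IsDualForm.smul {f : BinaryCubic ℤ} (hf : IsDualForm f) (c : ℤ) : IsDualForm (c • f) :=
  ⟨by rw [smul_b]; exact hf.1.mul_left c, by rw [smul_c]; exact hf.2.mul_left c⟩

/-- `⟨f, u·y⟩ = u·⟨f, y⟩` (the pairing is linear in `y`). [folklore] -/
theorem dualPairing_smul_right (f : BinaryCubic ℤ) (u : ZMod m) (y : BinaryCubic (ZMod m)) :
    dualPairing f (u • y) = u * dualPairing f y := by
  simp only [dualPairing, smul_a, smul_b, smul_c, smul_d]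
  ring

/-- **The pairing commutes with reduction `ℤ/nℤ → ℤ/dℤ` (`d ∣ n`)**: `⟨f, y⟩ mod d = ⟨f, y mod d⟩`. [folklore] -/
theorem cast_dualPairing {n d : ℕ} (h : d ∣ n) (f : BinaryCubic ℤ) (y : BinaryCubic (ZMod n)) :
    (ZMod.cast (dualPairing f y) : ZMod d) = dualPairing f (y.map (ZMod.castHom h (ZMod d))) := by
  rw [← ZMod.castHom_apply (h := h)]
  simp only [dualPairing, map_sub, map_add, map_mul, map_intCast, map_a, map_b, map_c, map_d]

/-- `e(j/m) = exp(2πi j/m)` for an integer `j`. [folklore] -/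
theorem eMod_intCast [NeZero m] (j : ℤ) : eMod ((j : ZMod m)) = Complex.exp (2 * Real.pi * I * j / m) := by
  rw [eMod_eq_stdAddChar, ZMod.stdAddChar_coe]

/-- **Splitting the character by Bézout**: `e(t/(n₁n₂)) = e(c₁t/n₁)·e(c₂t/n₂)` whenever `c₁n₂ + c₂n₁ = 1`
(`1/(n₁n₂) = c₁/n₁ + c₂/n₂`). [folklore] -/
theorem eMod_eq_mul_of_bezout {n₁ n₂ : ℕ} [NeZero n₁] [NeZero n₂] {c₁ c₂ : ℤ}
    (hbez : c₁ * n₂ + c₂ * n₁ = 1) (t : ZMod (n₁ * n₂)) :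
    eMod t = eMod (((c₁ * (t.val : ℤ) : ℤ) : ZMod n₁)) * eMod (((c₂ * (t.val : ℤ) : ℤ) : ZMod n₂)) := by
  haveI : NeZero (n₁ * n₂) := ⟨mul_ne_zero (NeZero.ne n₁) (NeZero.ne n₂)⟩
  have ht : eMod t = eMod (((t.val : ℤ) : ZMod (n₁ * n₂))) := by
    rw [Int.cast_natCast, ZMod.natCast_zmod_val]
  rw [ht, eMod_intCast, eMod_intCast, eMod_intCast, ← Complex.exp_add]
  congr 1
  have hn₁ : (n₁ : ℂ) ≠ 0 := Nat.cast_ne_zero.mpr (NeZero.ne n₁)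
  have hn₂ : (n₂ : ℂ) ≠ 0 := Nat.cast_ne_zero.mpr (NeZero.ne n₂)
  have hbez' : (c₁ : ℂ) * n₂ + c₂ * n₁ = 1 := by exact_mod_cast hbez
  push_cast
  rw [div_add_div _ _ hn₁ hn₂, div_eq_div_iff (mul_ne_zero hn₁ hn₂) (mul_ne_zero hn₁ hn₂)]
  linear_combination (-(2 * (Real.pi : ℂ) * I * ((ZMod.val t : ℕ) : ℂ) * ((n₁ : ℂ) * (n₂ : ℂ)))) * hbez'

end Pairing

/-! ### The Chinese remainder theorem on `V(ℤ/n₁n₂ℤ)` and multiplicativity of `Φ̂` -/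

section CRT

/-- The CRT reduction map `V(ℤ/n₁n₂ℤ) → V(ℤ/n₁ℤ) × V(ℤ/n₂ℤ)`. [folklore] -/
def crtForms (n₁ n₂ : ℕ) (y : BinaryCubic (ZMod (n₁ * n₂))) : BinaryCubic (ZMod n₁) × BinaryCubic (ZMod n₂) :=
  (y.map (ZMod.castHom (dvd_mul_right n₁ n₂) (ZMod n₁)), y.map (ZMod.castHom (dvd_mul_left n₂ n₁) (ZMod n₂)))

/-- An element of `ℤ/n₁n₂ℤ` vanishing mod `n₁` and mod `n₂` (coprime) vanishes. [folklore] -/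
theorem eq_zero_of_cast_eq_zero {n₁ n₂ : ℕ} [NeZero n₁] [NeZero n₂] (hcop : n₁.Coprime n₂) (x : ZMod (n₁ * n₂))
    (h1 : ZMod.castHom (dvd_mul_right n₁ n₂) (ZMod n₁) x = 0) (h2 : ZMod.castHom (dvd_mul_left n₂ n₁) (ZMod n₂) x = 0) :
    x = 0 := by
  haveI : NeZero (n₁ * n₂) := ⟨mul_ne_zero (NeZero.ne n₁) (NeZero.ne n₂)⟩
  rw [ZMod.castHom_apply, ZMod.cast_eq_val, ZMod.natCast_eq_zero_iff] at h1 h2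
  rw [← ZMod.natCast_zmod_val x, ZMod.natCast_eq_zero_iff]
  exact hcop.mul_dvd_of_dvd_of_dvd h1 h2

/-- **CRT: the reduction map `V(ℤ/n₁n₂ℤ) → V(ℤ/n₁ℤ) × V(ℤ/n₂ℤ)` is a bijection for coprime `n₁, n₂`.** [folklore] -/
theorem crtForms_bijective {n₁ n₂ : ℕ} [NeZero n₁] [NeZero n₂] (hcop : n₁.Coprime n₂) :
    Function.Bijective (crtForms n₁ n₂) := by
  haveI : NeZero (n₁ * n₂) := ⟨mul_ne_zero (NeZero.ne n₁) (NeZero.ne n₂)⟩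
  have key : ∀ u v : ZMod (n₁ * n₂),
      ZMod.castHom (dvd_mul_right n₁ n₂) (ZMod n₁) u = ZMod.castHom (dvd_mul_right n₁ n₂) (ZMod n₁) v →
      ZMod.castHom (dvd_mul_left n₂ n₁) (ZMod n₂) u = ZMod.castHom (dvd_mul_left n₂ n₁) (ZMod n₂) v → u = v := by
    intro u v h1 h2
    have h := eq_zero_of_cast_eq_zero hcop (u - v) (by rw [map_sub, h1, sub_self]) (by rw [map_sub, h2, sub_self])
    exact sub_eq_zero.mp h
  have hinj : Function.Injective (crtForms n₁ n₂) := by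
    intro x y hxy
    simp only [crtForms, Prod.mk.injEq, BinaryCubic.ext_iff, map_a, map_b, map_c, map_d] at hxy
    obtain ⟨⟨ha1, hb1, hc1, hd1⟩, ⟨ha2, hb2, hc2, hd2⟩⟩ := hxy
    exact BinaryCubic.ext (key _ _ ha1 ha2) (key _ _ hb1 hb2) (key _ _ hc1 hc2) (key _ _ hd1 hd2)
  refine (Fintype.bijective_iff_injective_and_card _).mpr ⟨hinj, ?_⟩
  rw [Fintype.card_prod, card_binaryCubic_zmod, card_binaryCubic_zmod, card_binaryCubic_zmod, mul_pow]

/-- **Multiplicativity of the Fourier transform (eq:FT) under the Chinese remainder theorem.** If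
`n = n₁n₂` with `(n₁, n₂) = 1` and `Φ = Φ₁ ⊗ Φ₂` (i.e. `Φ(y) = Φ₁(y mod n₁)·Φ₂(y mod n₂)`), then for `f` in
the dual lattice and Bézout coefficients `c₁n₂ + c₂n₁ = 1`,
`Φ̂(f) = Φ̂₁(c₁f)·Φ̂₂(c₂f)` — "the function `Ψ̂_{q²}(x)` is multiplicative in `q`" (BTT Prop. 5.2, first
clause; the unit scalings `cᵢ` are harmless, `fourierDual_psiLocal_smul`).
[cite: BhargavaTaniguchiThorne2023, Prop. 5.2 (multiplicativity of Ψ̂_{q²} in q)] -/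
theorem fourierDual_eq_mul_of_coprime {n n₁ n₂ : ℕ} [NeZero n₁] [NeZero n₂] (hn : n = n₁ * n₂)
    (hcop : n₁.Coprime n₂) (h₁ : n₁ ∣ n) (h₂ : n₂ ∣ n)
    {Φ : BinaryCubic (ZMod n) → ℂ} {Φ₁ : BinaryCubic (ZMod n₁) → ℂ} {Φ₂ : BinaryCubic (ZMod n₂) → ℂ}
    (hΦ : ∀ y, Φ y = Φ₁ (y.map (ZMod.castHom h₁ (ZMod n₁))) * Φ₂ (y.map (ZMod.castHom h₂ (ZMod n₂))))
    {f : BinaryCubic ℤ} (hf : IsDualForm f) {c₁ c₂ : ℤ} (hbez : c₁ * n₂ + c₂ * n₁ = 1) :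
    fourierDual Φ f = fourierDual Φ₁ (c₁ • f) * fourierDual Φ₂ (c₂ • f) := by
  subst hn
  haveI : NeZero (n₁ * n₂) := ⟨mul_ne_zero (NeZero.ne n₁) (NeZero.ne n₂)⟩
  have hterm : ∀ y : BinaryCubic (ZMod (n₁ * n₂)), Φ y * eMod (dualPairing f y) =
      (Φ₁ (y.map (ZMod.castHom h₁ (ZMod n₁))) * eMod (dualPairing (c₁ • f) (y.map (ZMod.castHom h₁ (ZMod n₁))))) *
      (Φ₂ (y.map (ZMod.castHom h₂ (ZMod n₂))) * eMod (dualPairing (c₂ • f) (y.map (ZMod.castHom h₂ (ZMod n₂))))) := by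
    intro y
    have e1 : (((c₁ * ((dualPairing f y).val : ℤ)) : ℤ) : ZMod n₁) = dualPairing (c₁ • f) (y.map (ZMod.castHom h₁ (ZMod n₁))) := by
      rw [Int.cast_mul, Int.cast_natCast, ZMod.natCast_val, cast_dualPairing h₁ f y, ← dualPairing_smul hf]
    have e2 : (((c₂ * ((dualPairing f y).val : ℤ)) : ℤ) : ZMod n₂) = dualPairing (c₂ • f) (y.map (ZMod.castHom h₂ (ZMod n₂))) := by
      rw [Int.cast_mul, Int.cast_natCast, ZMod.natCast_val, cast_dualPairing h₂ f y, ← dualPairing_smul hf]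
    rw [hΦ y, eMod_eq_mul_of_bezout hbez (dualPairing f y), e1, e2]
    ring
  rw [fourierDual_eq_sum, fourierDual_eq_sum, fourierDual_eq_sum]
  have hsum : ∑ y : BinaryCubic (ZMod (n₁ * n₂)), Φ y * eMod (dualPairing f y) =
      (∑ y₁ : BinaryCubic (ZMod n₁), Φ₁ y₁ * eMod (dualPairing (c₁ • f) y₁)) *
      (∑ y₂ : BinaryCubic (ZMod n₂), Φ₂ y₂ * eMod (dualPairing (c₂ • f) y₂)) := by
    calc ∑ y : BinaryCubic (ZMod (n₁ * n₂)), Φ y * eMod (dualPairing f y)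
        = ∑ z : BinaryCubic (ZMod n₁) × BinaryCubic (ZMod n₂),
            (Φ₁ z.1 * eMod (dualPairing (c₁ • f) z.1)) * (Φ₂ z.2 * eMod (dualPairing (c₂ • f) z.2)) :=
          Fintype.sum_bijective _ (crtForms_bijective hcop) _ _ hterm
      _ = _ := by simp only [Fintype.sum_prod_type, Finset.sum_mul_sum]
  rw [hsum]
  push_cast
  ring

end CRT

/-! ### Scaling by units; `Ψ̂_{p²}(c·f) = Ψ̂_{p²}(f)` for `p ∤ c` -/

section Local

variable {p : ℕ} [hp : Fact p.Prime]

/-- Scaling by a unit is a bijection of `V(R)`. [folklore] -/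
theorem smul_bijective_of_isUnit {R : Type*} [CommRing R] {u : R} (hu : IsUnit u) :
    Function.Bijective (fun y : BinaryCubic R => u • y) := by
  obtain ⟨v, hv⟩ := hu.exists_left_inv
  refine Function.bijective_iff_has_inverse.mpr ⟨fun y => v • y, fun y => ?_, fun y => ?_⟩
  · show v • (u • y) = y
    rw [← mul_smul, hv, one_smul]
  · show u • (v • y) = y
    rw [← mul_smul, mul_comm, hv, one_smul]

omit hp in
/-- `Ψ_{p²}(u·y) = Ψ_{p²}(y)` for a unit `u` (`Disc(u·y) = u⁴ Disc(y)`). [folklore] -/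
theorem psiLocal_smul {u : ZMod (p ^ 2)} (hu : IsUnit u) (y : BinaryCubic (ZMod (p ^ 2))) :
    psiLocal p (u • y) = psiLocal p y := by
  unfold psiLocal
  rw [disc_smul]
  by_cases h : y.disc = 0
  · rw [if_pos h, if_pos ((hu.pow 4).mul_right_eq_zero.mpr h)]
  · rw [if_neg h, if_neg (mt (hu.pow 4).mul_right_eq_zero.mp h)]

/-- An integer prime to `p` is a unit modulo `p²`. [folklore] -/
theorem isUnit_intCast_sq_of_not_dvd {c : ℤ} (hc : ¬ (p : ℤ) ∣ c) : IsUnit ((c : ZMod (p ^ 2))) := by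
  rw [ZMod.coe_int_isUnit_iff_isCoprime, Nat.cast_pow]
  exact ((Prime.coprime_iff_not_dvd (Nat.prime_iff_prime_int.mp hp.out)).mpr hc).pow_left

/-- **`Ψ̂_{p²}(c·f) = Ψ̂_{p²}(f)` for `p ∤ c`** and `f` in the dual lattice: substitute `y ↦ c̄·y` in (eq:FT).
(This absorbs the Bézout units of `fourierDual_eq_mul_of_coprime`.) [folklore] -/
theorem fourierDual_psiLocal_smul {f : BinaryCubic ℤ} (hf : IsDualForm f) {c : ℤ} (hc : ¬ (p : ℤ) ∣ c) :
    fourierDual (psiLocal p) (c • f) = fourierDual (psiLocal p) f := by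
  have hu : IsUnit ((c : ZMod (p ^ 2))) := isUnit_intCast_sq_of_not_dvd hc
  rw [fourierDual_eq_sum, fourierDual_eq_sum]
  congr 1
  calc ∑ y, psiLocal p y * eMod (dualPairing (c • f) y)
      = ∑ y, psiLocal p ((c : ZMod (p ^ 2)) • y) * eMod (dualPairing f ((c : ZMod (p ^ 2)) • y)) := by
        refine Finset.sum_congr rfl fun y _ => ?_
        rw [psiLocal_smul hu, dualPairing_smul hf, dualPairing_smul_right]
    _ = ∑ y, psiLocal p y * eMod (dualPairing f y) :=
        (smul_bijective_of_isUnit hu).sum_comp (fun y => psiLocal p y * eMod (dualPairing f y))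

end Local

/-! ### Peeling one prime off `Ψ_{q²}`: `Φ_{pq'} = Ψ_{p²} ⊗ Φ_{q'}` on `V(ℤ/16p²q'²ℤ)` -/

section Peel

/-- `p² ∣ 16(pq')²`. [folklore] -/
theorem level_dvd_sq {p q' : ℕ} : p ^ 2 ∣ 16 * (p * q') ^ 2 := ⟨16 * q' ^ 2, by ring⟩

/-- `16q'² ∣ 16(pq')²`. [folklore] -/
theorem level_dvd_rest {p q' : ℕ} : 16 * q' ^ 2 ∣ 16 * (p * q') ^ 2 := ⟨p ^ 2, by ring⟩

/-- Iterated reduction `ℤ/n → ℤ/k → ℤ/d` (`d ∣ k ∣ n`) is reduction `ℤ/n → ℤ/d`. [folklore] -/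
theorem cast_cast_of_dvd {n k d : ℕ} (hd : d ∣ k) (hk : k ∣ n) (x : ZMod n) :
    (ZMod.cast (ZMod.cast x : ZMod k) : ZMod d) = (ZMod.cast x : ZMod d) := by
  rw [← ZMod.castHom_apply (h := hk), ← ZMod.castHom_apply (R := ZMod d) (h := hd),
    ← ZMod.castHom_apply (R := ZMod d) (h := hd.trans hk), ← RingHom.comp_apply, ZMod.castHom_comp]

/-- **`Φ_{pq'}(y) = Ψ_{p²}(y mod p²) · Φ_{q'}(y mod 16q'²)`** for an odd prime `p ∤ q'`: the local condition of
`psiMod` at `p` is `p² ∣ Disc`, i.e. `psiLocal p`, and the conditions at the primes of `q'` are read modulo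
`16q'²`. (`Ψ_{q²} := ⊗_{p ∣ q} Ψ_{p²}`.) [cite: BhargavaTaniguchiThorne2023, §5 (Ψ_{q²} := ⊗_{p∣q} Ψ_{p²})] -/
theorem psiMod_peel {p q' : ℕ} [hp : Fact p.Prime] (hp2 : p ≠ 2) (hq'0 : q' ≠ 0)
    (y : BinaryCubic (ZMod (16 * (p * q') ^ 2))) :
    psiMod (p * q') y = psiLocal p (y.map (ZMod.castHom level_dvd_sq (ZMod (p ^ 2)))) *
      psiMod q' (y.map (ZMod.castHom level_dvd_rest (ZMod (16 * q' ^ 2)))) := by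
  have hpf : (p * q').primeFactors = insert p q'.primeFactors := by
    rw [Nat.primeFactors_mul hp.out.ne_zero hq'0, hp.out.primeFactors, Finset.insert_eq]
  have hA : IsNonFundModAt p y.disc ↔ ZMod.castHom level_dvd_sq (ZMod (p ^ 2)) y.disc = 0 := by
    rw [IsNonFundModAt, if_neg hp2, ZMod.castHom_apply]
  have hB : ∀ r ∈ q'.primeFactors, (IsNonFundModAt r y.disc ↔
      IsNonFundModAt r (ZMod.castHom level_dvd_rest (ZMod (16 * q' ^ 2)) y.disc)) := by
    intro r hr
    unfold IsNonFundModAt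
    rw [ZMod.castHom_apply]
    split_ifs with hr2
    · rw [cast_cast_of_dvd (dvd_mul_right 16 (q' ^ 2)) level_dvd_rest]
    · rw [cast_cast_of_dvd ((level_dvd hr).2 hr2) level_dvd_rest]
  have hiff : (∀ r ∈ (p * q').primeFactors, IsNonFundModAt r y.disc) ↔
      ((y.map (ZMod.castHom level_dvd_sq (ZMod (p ^ 2)))).disc = 0 ∧
        ∀ r ∈ q'.primeFactors, IsNonFundModAt r (y.map (ZMod.castHom level_dvd_rest (ZMod (16 * q' ^ 2)))).disc) := by
    rw [hpf, Finset.forall_mem_insert, disc_map, disc_map, hA]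
    exact and_congr Iff.rfl (forall₂_congr hB)
  unfold psiMod psiLocal
  split_ifs <;> first | (simp; done) | (exfalso; tauto)

/-- **`|Φ̂_q(f)| ≤ ∏_{p ∣ q, p ≥ 5} |Ψ̂_{p²}(f)|`** for squarefree `q` and `f` in the dual lattice: peel the
primes `p ≥ 5` one at a time (`fourierDual_eq_mul_of_coprime`, `psiMod_peel`), absorb the Bézout units
(`fourierDual_psiLocal_smul`), and bound the remaining factor at level `16·q₀²`, `q₀ ∣ 6`, trivially by `1`.
This is the form in which the multiplicativity of `Ψ̂_{q²}` (BTT Prop. 5.2) enters the proof of Prop. 5.1.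
[cite: BhargavaTaniguchiThorne2023, Prop. 5.2 (Ψ̂_{q²} multiplicative in q)] -/
theorem norm_fourierDual_psiMod_le {q : ℕ} (hq : Squarefree q) {f : BinaryCubic ℤ} (hf : IsDualForm f) :
    ‖fourierDual (psiMod q) f‖ ≤ ∏ p ∈ q.primeFactors.filter (5 ≤ ·), ‖fourierDual (psiLocal p) f‖ := by
  induction q using Nat.strong_induction_on generalizing f with
  | _ q ih =>
  by_cases hex : ∃ p ∈ q.primeFactors, 5 ≤ p
  · obtain ⟨p, hpmem, hp5⟩ := hex
    have hpp : p.Prime := Nat.prime_of_mem_primeFactors hpmem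
    haveI := Fact.mk hpp
    obtain ⟨q', rfl⟩ := Nat.dvd_of_mem_primeFactors hpmem
    have hq'0 : q' ≠ 0 := by
      rintro rfl
      rw [mul_zero] at hq
      exact not_squarefree_zero hq
    have hpq' : ¬ p ∣ q' := fun h => hpp.one_lt.ne' (Nat.isUnit_iff.mp (hq p (Nat.mul_dvd_mul_left p h)))
    have hp2 : p ≠ 2 := by omega
    haveI : NeZero (16 * q' ^ 2) := ⟨mul_ne_zero (by norm_num) (pow_ne_zero 2 hq'0)⟩
    have hcopp : Nat.Coprime p (16 * q' ^ 2) := by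
      rw [Nat.Prime.coprime_iff_not_dvd hpp]
      intro h
      rcases (Nat.Prime.dvd_mul hpp).mp h with h16 | hq2
      · rw [show (16 : ℕ) = 2 ^ 4 by norm_num] at h16
        exact hp2 ((Nat.prime_dvd_prime_iff_eq hpp Nat.prime_two).mp (hpp.dvd_of_dvd_pow h16))
      · exact hpq' (hpp.dvd_of_dvd_pow hq2)
    have hcop : Nat.Coprime (p ^ 2) (16 * q' ^ 2) := hcopp.pow_left 2
    obtain ⟨u, v, huv⟩ := Nat.isCoprime_iff_coprime.mpr hcop
    have hfac := fourierDual_eq_mul_of_coprime (n := 16 * (p * q') ^ 2) (by ring) hcop level_dvd_sq level_dvd_rest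
      (psiMod_peel hp2 hq'0) hf (c₁ := v) (c₂ := u) (by linear_combination huv)
    -- the Bézout coefficients are units at the relevant primes
    have hv : ¬ (p : ℤ) ∣ v := by
      intro h
      have h1 : (p : ℤ) ∣ 1 := by
        rw [← huv]
        refine dvd_add (dvd_mul_of_dvd_right ?_ _) (dvd_mul_of_dvd_left h _)
        push_cast
        exact dvd_pow_self _ two_ne_zero
      exact hpp.one_lt.ne' (Nat.dvd_one.mp (Int.natCast_dvd_natCast.mp h1))
    have hu : ∀ r ∈ q'.primeFactors, ¬ (r : ℤ) ∣ u := by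
      intro r hr h
      have hrp : r.Prime := Nat.prime_of_mem_primeFactors hr
      have h1 : (r : ℤ) ∣ 1 := by
        rw [← huv]
        refine dvd_add (dvd_mul_of_dvd_left h _) (dvd_mul_of_dvd_right ?_ _)
        push_cast
        exact dvd_mul_of_dvd_right (dvd_pow (Int.natCast_dvd_natCast.mpr (Nat.dvd_of_mem_primeFactors hr)) two_ne_zero) _
      exact hrp.one_lt.ne' (Nat.dvd_one.mp (Int.natCast_dvd_natCast.mp h1))
    have hlt : q' < p * q' := lt_mul_left (Nat.pos_of_ne_zero hq'0) hpp.one_lt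
    have ih' := ih q' hlt hq.of_mul_right (hf.smul u)
    have hpf : (p * q').primeFactors.filter (5 ≤ ·) = insert p (q'.primeFactors.filter (5 ≤ ·)) := by
      rw [Nat.primeFactors_mul hpp.ne_zero hq'0, hpp.primeFactors, Finset.filter_union, Finset.filter_singleton,
        if_pos hp5, Finset.insert_eq]
    have hpnot : p ∉ q'.primeFactors.filter (5 ≤ ·) := fun h =>
      hpq' (Nat.dvd_of_mem_primeFactors (Finset.mem_filter.mp h).1)
    rw [hfac, norm_mul, hpf, Finset.prod_insert hpnot, fourierDual_psiLocal_smul hf hv]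
    refine mul_le_mul_of_nonneg_left ?_ (norm_nonneg _)
    calc ‖fourierDual (psiMod q') (u • f)‖
        ≤ ∏ r ∈ q'.primeFactors.filter (5 ≤ ·), ‖fourierDual (psiLocal r) (u • f)‖ := ih'
      _ = ∏ r ∈ q'.primeFactors.filter (5 ≤ ·), ‖fourierDual (psiLocal r) f‖ := by
          refine Finset.prod_congr rfl fun r hr => ?_
          have hr' := (Finset.mem_filter.mp hr).1
          haveI := Fact.mk (Nat.prime_of_mem_primeFactors hr')
          rw [fourierDual_psiLocal_smul hf (hu r hr')]
  · have hempty : q.primeFactors.filter (5 ≤ ·) = ∅ :=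
      Finset.filter_eq_empty_iff.mpr fun p hp h5 => hex ⟨p, hp, h5⟩
    rw [hempty, Finset.prod_empty]
    haveI : NeZero (16 * q ^ 2) := ⟨mul_ne_zero (by norm_num) (pow_ne_zero 2 hq.ne_zero)⟩
    exact norm_fourierDual_le (fun y => by rcases psiMod_eq_zero_or_one q y with h | h <;> simp [h]) f

end Peel

end Literature.NumberTheory.CubicFields

end
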